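import Summits.CriticalPhenomena.PercolationContinuityZ3.Theorems.Transplant.FKConnectivityAllQPat3CornerTsymData
import Summits.CriticalPhenomena.PercolationContinuityZ3.Theorems.Transplant.FKConnectivityAllQPat3CutSTsymData
import Summits.CriticalPhenomena.PercolationContinuityZ3.Theorems.Transplant.FKConnectivityAllQTsymSP
import HarnessLib

/-!
# Connectivity correlation inequalities for `φ_{w,q}`, every `q > 0` — CONJECTURE T on CORNER gluings of series–parallel pieces
# and ACROSS A SEPARATING MARK (census g36, extension; antipodal form of the S3 T_sym rows)

Theorems file (`--supports stmt-CriticalPhenomena-4575`), census lane `prim-bschramm-census` (gen 36) of the post-continuity programme (LANE 2 bschramm, FK sub-lane);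
builds on p205010 (kernel theorem, internal audit signed; external expert review pending).
No definitions, no named facts, no sorries; standard axioms.  **`FK.antipodalT_nonneg_corner`** — two TTSP pieces in parallel
between `u, v`, marks `(u, s, t)`: `antipodalT ≥ 0` for every apex and every `q > 0` (placement {terminal, inner, inner});
**`FK.antipodalT_nonneg_sepMark`** — ANY two graphs meeting in the single vertex `s`, marks `x`, `y` on the two sides:
`antipodalT ≥ 0` for every apex and every `q > 0` (Conjecture T holds whenever one mark separates the other two).
[cite: AyyerLinussonRavichandran2025, §7 eq. (13)–(15) (p. 22)] [cite: Grimmett2006, §3.8 (pp. 61–62)]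
-/

noncomputable section

namespace Summit.CriticalPhenomena.PercolationContinuityZ3.Theorems

namespace FK

open SimpleGraph Literature.Probability.LatticeModels Literature.Probability.Percolation

/-! ### Conjecture T on CORNER gluings and across a separating mark (census g36, extension) -/

section SPGraphs2

open scoped Classical

variable {V : Type*} [Fintype V]

/-- **NEW KERNEL ROW: CONJECTURE T ON TWO PARALLEL SERIES–PARALLEL PIECES, one mark AT a corner.**  For two two-terminal
series–parallel pieces `Q₁ ∋ s`, `Q₂ ∋ t` glued in parallel between `u ≠ v` (edge-disjoint, supports meeting inside `{u, v}`,
marks inner) and every `q > 0`: `0 ≤ antipodalT q z … (Q₁ ∪ Q₂) ∅` for each apex `z ∈ {u, s, t}` — the placement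
{terminal, inner, inner} of Conjecture T on two-terminal series–parallel networks (from `FK.cornerTsym_level_nonneg`).
[cite: AyyerLinussonRavichandran2025, §7 eq. (13)–(15) (p. 22)] -/
theorem antipodalT_nonneg_corner {q : ℝ} (hq : 0 < q) {E₁ E₂ : Finset (Sym2 V)} {V₁ V₂ : Set V} {u v s t : V}
    (hd : Disjoint E₁ E₂) (h₁ : ∀ e ∈ (↑E₁ : Set (Sym2 V)), ∀ z ∈ e, z ∈ V₁)
    (h₂ : ∀ e ∈ (↑E₂ : Set (Sym2 V)), ∀ z ∈ e, z ∈ V₂) (h12 : V₁ ∩ V₂ ⊆ ({u, v} : Set V)) (huv : u ≠ v)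
    (hs2 : s ∉ V₂) (ht1 : t ∉ V₁) (hsu : s ≠ u) (hsv : s ≠ v) (htu : t ≠ u) (htv : t ≠ v) (hst : s ≠ t)
    (h1sp : IsTTSP E₁ u v) (h2sp : IsTTSP E₂ u v) (hs1 : ∃ e ∈ E₁, s ∈ e) (ht2 : ∃ e ∈ E₂, t ∈ e) :
    0 ≤ antipodalT q u s t (↑(E₁ ∪ E₂) : BondConfig V) ∅ ∧ 0 ≤ antipodalT q s u t (↑(E₁ ∪ E₂) : BondConfig V) ∅ ∧
      0 ≤ antipodalT q t s u (↑(E₁ ∪ E₂) : BondConfig V) ∅ := by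
  have hw : ∀ n, 0 ≤ (fun n => q ^ n) n := fun n => pow_nonneg hq.le n
  have h0 := tval_tsym_nonneg_of_lev2 (by norm_num)
    (cornerTsym_level_nonneg hd h₁ h₂ h12 huv hs2 ht1 hsu hsv htu htv hst h1sp h2sp hs1 ht2) hw
  have hperm := tval_tsym_nonneg_perm h0
  refine ⟨?_, ?_, ?_⟩ <;> rw [antipodalT_eq_tval]
  · exact h0.trans (tval_mono tsymTab_le_tApexTab hw)
  · exact hperm.1.trans (tval_mono tsymTab_le_tApexTab hw)
  · exact hperm.2.trans (tval_mono tsymTab_le_tApexTab hw)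

/-- **NEW KERNEL ROW: CONJECTURE T ACROSS A SEPARATING MARK — UNCONDITIONAL, ALL GRAPHS.**  If `G = A ∪ B` with `A, B`
edge-disjoint and meeting in the single vertex `s`, and the marks `x ∈ A`, `y ∈ B` lie off the other side (so the mark `s`
separates `x` from `y`), then for every `q > 0`: `0 ≤ antipodalT q z … (A ∪ B) ∅` for each apex `z ∈ {x, y, s}` (from
`FK.cutSTsym_level_nonneg`, a zero-product certificate: the symmetrised target vanishes identically).
[cite: AyyerLinussonRavichandran2025, §7 eq. (13)–(15) (p. 22)] -/
theorem antipodalT_nonneg_sepMark {q : ℝ} (hq : 0 < q) {E₁ E₂ : Finset (Sym2 V)} {V₁ V₂ : Set V} {x y s : V}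
    (hd : Disjoint E₁ E₂) (h₁ : ∀ e ∈ (↑E₁ : Set (Sym2 V)), ∀ z ∈ e, z ∈ V₁)
    (h₂ : ∀ e ∈ (↑E₂ : Set (Sym2 V)), ∀ z ∈ e, z ∈ V₂) (hS : V₁ ∩ V₂ ⊆ ({s} : Set V)) (hxV : x ∉ V₂)
    (hyV : y ∉ V₁) (hxs : x ≠ s) (hys : y ≠ s) (hxy : x ≠ y) :
    0 ≤ antipodalT q x y s (↑(E₁ ∪ E₂) : BondConfig V) ∅ ∧ 0 ≤ antipodalT q y x s (↑(E₁ ∪ E₂) : BondConfig V) ∅ ∧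
      0 ≤ antipodalT q s y x (↑(E₁ ∪ E₂) : BondConfig V) ∅ := by
  have hw : ∀ n, 0 ≤ (fun n => q ^ n) n := fun n => pow_nonneg hq.le n
  have h0 := tval_tsym_nonneg_of_lev2 (by norm_num) (cutSTsym_level_nonneg hd h₁ h₂ hS hxV hyV hxs hys hxy) hw
  have hperm := tval_tsym_nonneg_perm h0
  refine ⟨?_, ?_, ?_⟩ <;> rw [antipodalT_eq_tval]
  · exact h0.trans (tval_mono tsymTab_le_tApexTab hw)
  · exact hperm.1.trans (tval_mono tsymTab_le_tApexTab hw)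
  · exact hperm.2.trans (tval_mono tsymTab_le_tApexTab hw)

end SPGraphs2

end FK

end Summit.CriticalPhenomena.PercolationContinuityZ3.Theorems

end
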